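import Summits.Parity.GeneralizedHardyLittlewood.Theorems.GreenTaoLevelTwoMNTwoRegroupedDenominator

/-!
# Route `GreenTaoLevelTwo`, crux `MNTwo` (stmt-Parity-21276), line `birth`, stub `stub_mnVertical`:
# the denominator step with polynomial constants (GT 2008b §10, end of the proof of Lemma 24)

Step 9 of the remaining Lemma-24 assembly for `stub_mnVertical` with the parameters of
`…MNTwoRegroupedDenominator.regrouped_denominator` CHOSEN and its largeness conditions `H1–H6`
DISCHARGED (B. Green, T. Tao, *Quadratic uniformity of the Möbius function*, Ann. Inst. Fourier 58
(2008) = arXiv:math/0606087, §10: "Since `q''q'q ≲ 1`, the proof of Lemma 24 is complete").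
Def-free, pure arithmetic: with `κ = η¹⁶`, `δB = (κ/2)³/51344`, `δC = δB³/51344`, the conditions
hold as soon as `2L+1, 2M+1 ≥ K₀/κ³⁴` (`K₀` an absolute constant), and then
`q ≤ K_q/κ²⁶`, `‖q·2θ‖_{ℝ/ℤ} ≤ K_d/(κ⁷⁹(2L+1)²(2M+1)²)`.

* `regrouped_denominator_poly` — the statement just described.

References: [GreenTao2008QuadraticMobius] arXiv:math/0606087 §10 (proof of Lemma 24), App. A.
-/

noncomputable section

open Finset
open scoped FourierTransform

namespace Summit.Parity.GeneralizedHardyLittlewood.GreenTaoLevelTwoMNTwoRegroupedDenominatorPoly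

open Literature.NumberTheory.Sieve.Vinogradov (distInt)
open Summit.Parity.GeneralizedHardyLittlewood.GreenTaoLevelTwoMNTwoRegroupedDenominator
  (regrouped_denominator)

/-- **Denominator extraction with polynomial constants.**  Hypotheses as in
`…MNTwoRegroupedDenominator.regrouped_denominator` except that the `δ`-parameters are fixed and
`H1–H6` are replaced by `K₀/κ³⁴ ≤ 2L+1, 2M+1` (`κ = η¹⁶`, `K₀ = 10⁵⁰`); conclusion:
`1 ≤ q ≤ 10⁷⁰/κ²⁶` and `‖q·2θ‖_{ℝ/ℤ} ≤ 10²⁰⁰/(κ⁷⁹(2L+1)²(2M+1)²)`.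
[cite: GreenTao2008QuadraticMobius, §10 (proof of Lemma 24), App. A Lemma 32] -/
theorem regrouped_denominator_poly (wt : ℤ → ℤ → ℝ) (hwt : ∀ l m, |wt l m| ≤ 1)
    (χ₁ χ₂ : ℤ → ℤ → ℝ) (hχ₁ : ∀ x y, |χ₁ x y| ≤ 1) (hχ₂ : ∀ x y, |χ₂ x y| ≤ 1)
    (β θ : ℝ) (d w s t l₀ m₀ : ℤ) {L M : ℕ} {η : ℝ} (hη : 0 < η) (hη1 : η ≤ 1)
    (hLbig : (10 : ℝ) ^ 50 / (η ^ 16) ^ 34 ≤ (((L : ℤ) - (-(L : ℤ)) + 1 : ℤ) : ℝ))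
    (hMbig : (10 : ℝ) ^ 50 / (η ^ 16) ^ 34 ≤ (((M : ℤ) - (-(M : ℤ)) + 1 : ℤ) : ℝ))
    (hlarge : η * (((L : ℤ) - (-(L : ℤ)) + 1 : ℤ) : ℝ) * (((L : ℤ) - (-(L : ℤ)) + 1 : ℤ) : ℝ) *
        (((M : ℤ) - (-(M : ℤ)) + 1 : ℤ) : ℝ) * (((M : ℤ) - (-(M : ℤ)) + 1 : ℤ) : ℝ) ≤
      ‖∑ l₁ ∈ Icc (-(L : ℤ)) L, ∑ m₁ ∈ Icc (-(M : ℤ)) M, ∑ l₂ ∈ Icc (-(L : ℤ)) L,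
        ∑ m₂ ∈ Icc (-(M : ℤ)) M,
        (((wt l₀ m₀ * wt l₀ (m₀ + m₁) * wt (l₀ + l₁) m₀ * wt (l₀ + l₁) (m₀ + m₁)) *
            (wt l₀ (m₀ + m₂) * wt l₀ (m₀ + m₂ + m₁) * wt (l₀ + l₁) (m₀ + m₂) *
              wt (l₀ + l₁) (m₀ + m₂ + m₁)) *
            (wt (l₀ + l₂) m₀ * wt (l₀ + l₂) (m₀ + m₁) * wt (l₀ + l₂ + l₁) m₀ *
              wt (l₀ + l₂ + l₁) (m₀ + m₁)) *
            (wt (l₀ + l₂) (m₀ + m₂) * wt (l₀ + l₂) (m₀ + m₂ + m₁) * wt (l₀ + l₂ + l₁) (m₀ + m₂)) *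
            χ₁ l₁ l₂ * χ₂ m₁ m₂ : ℝ) : ℂ) *
          (𝐞 (β * ((d + s * (l₀ + l₂ + l₁)) * (w + t * (m₀ + m₂ + m₁)) : ℤ)) : ℂ) *
          (𝐞 (2 * θ * l₁ * l₂ * m₁ * m₂) : ℂ)‖) :
    ∃ q : ℕ, 1 ≤ q ∧ (q : ℝ) ≤ (10 : ℝ) ^ 70 / (η ^ 16) ^ 26 ∧
      distInt (q * (2 * θ)) ≤
        (10 : ℝ) ^ 200 / ((η ^ 16) ^ 79 * ((((L : ℤ) - (-(L : ℤ)) + 1 : ℤ) : ℝ) ^ 2 *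
          (((M : ℤ) - (-(M : ℤ)) + 1 : ℤ) : ℝ) ^ 2)) := by
  -- `κ = η¹⁶ ∈ (0,1]` and the box sizes
  set κ : ℝ := η ^ 16 with hκ
  have hκpos : 0 < κ := by rw [hκ]; positivity
  have hκ1 : κ ≤ 1 := by rw [hκ]; exact pow_le_one₀ hη.le hη1
  set nL : ℝ := (((L : ℤ) - (-(L : ℤ)) + 1 : ℤ) : ℝ) with hnL
  set nM : ℝ := (((M : ℤ) - (-(M : ℤ)) + 1 : ℤ) : ℝ) with hnM
  have hκ34 : 0 < κ ^ 34 := by positivity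
  have hnL34 : (10 : ℝ) ^ 50 ≤ κ ^ 34 * nL := by
    rw [div_le_iff₀ hκ34] at hLbig; linarith
  have hnM34 : (10 : ℝ) ^ 50 ≤ κ ^ 34 * nM := by
    rw [div_le_iff₀ hκ34] at hMbig; linarith
  have hκ34le : κ ^ 34 ≤ 1 := pow_le_one₀ hκpos.le hκ1
  have hnL0 : (10 : ℝ) ^ 50 ≤ nL := by
    have h1 : κ ^ 34 * nL ≤ 1 * nL := by
      have : 0 ≤ nL := by
        by_contra h
        push Not at h
        nlinarith [hnL34]
      exact mul_le_mul_of_nonneg_right hκ34le this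
    linarith
  have hnM0 : (10 : ℝ) ^ 50 ≤ nM := by
    have h1 : κ ^ 34 * nM ≤ 1 * nM := by
      have : 0 ≤ nM := by
        by_contra h
        push Not at h
        nlinarith [hnM34]
      exact mul_le_mul_of_nonneg_right hκ34le this
    linarith
  have hnLpos : 0 < nL := by linarith
  have hnMpos : 0 < nM := by linarith
  -- `κ^a n ≥ 10^50` for `a ≤ 34`
  have hpowL : ∀ a : ℕ, a ≤ 34 → (10 : ℝ) ^ 50 ≤ κ ^ a * nL := by
    intro a ha
    have : κ ^ 34 ≤ κ ^ a := pow_le_pow_of_le_one hκpos.le hκ1 ha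
    nlinarith [hnL34, this, hnLpos]
  have hpowM : ∀ a : ℕ, a ≤ 34 → (10 : ℝ) ^ 50 ≤ κ ^ a * nM := by
    intro a ha
    have : κ ^ 34 ≤ κ ^ a := pow_le_pow_of_le_one hκpos.le hκ1 ha
    nlinarith [hnM34, this, hnMpos]
  -- the parameters (the absolute constant `51344` is kept symbolic)
  set c : ℝ := (51344 : ℝ) with hc
  have hcpos : 0 < c := by rw [hc]; norm_num
  set δ₁A : ℝ := 1 / (κ * nM) with hδ₁A
  set δB : ℝ := (κ / 2) ^ 3 / c with hδB
  set δ₁B : ℝ := 2630455808 * 64 * δ₁A / ((κ / 2) ^ 6 * nM) with hδ₁B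
  set δC : ℝ := δB ^ 3 / c with hδC
  set δ₁C : ℝ := 2630455808 * 64 * δ₁B / (δB ^ 6 * nL) with hδ₁C
  have hδBpos : 0 < δB := by rw [hδB]; positivity
  have hδCpos : 0 < δC := by rw [hδC]; positivity
  -- closed forms
  have eδ₁B : δ₁B = 2630455808 * 64 * 64 / (κ ^ 7 * nM ^ 2) := by
    rw [hδ₁B, hδ₁A]; field_simp; ring
  have eδB8 : δB / 8 = κ ^ 3 / (64 * c) := by rw [hδB]; field_simp; ring
  have eδ₁C : δ₁C = 2630455808 ^ 2 * 64 ^ 3 * (8 * c) ^ 6 / (κ ^ 25 * nL * nM ^ 2) := by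
    rw [hδ₁C, eδ₁B, hδB]; field_simp; ring
  have eδC8 : δC / 8 = κ ^ 9 / (8 * ((8 * c) ^ 3 * c)) := by rw [hδC, hδB]; field_simp; ring
  -- H1–H6
  have H1 : δ₁A ≤ κ / 16 := by
    rw [hδ₁A, div_le_div_iff₀ (by positivity) (by norm_num)]
    have h2 := hpowM 2 (by norm_num)
    have e : κ * (κ * nM) = κ ^ 2 * nM := by ring
    rw [e]
    have : (1 * 16 : ℝ) ≤ 10 ^ 50 := by norm_num
    linarith
  have H2 : 2 < (κ / 4) ^ 2 * nM := by
    have h2 := hpowM 2 (by norm_num)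
    have e : (κ / 4) ^ 2 * nM = κ ^ 2 * nM / 16 := by ring
    rw [e, lt_div_iff₀ (by norm_num)]
    have : (2 * 16 : ℝ) < 10 ^ 50 := by norm_num
    linarith
  have H3 : δ₁B ≤ δB / 8 := by
    rw [eδ₁B, eδB8, div_le_div_iff₀ (by positivity) (by norm_num)]
    have h5 := hpowM 5 (by norm_num)
    have h10 : (10 : ℝ) ^ 100 ≤ κ ^ 10 * nM ^ 2 := by
      have := pow_le_pow_left₀ (by positivity) h5 2
      calc (10 : ℝ) ^ 100 = ((10 : ℝ) ^ 50) ^ 2 := by norm_num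
        _ ≤ (κ ^ 5 * nM) ^ 2 := this
        _ = κ ^ 10 * nM ^ 2 := by ring
    have e : κ ^ 3 * (κ ^ 7 * nM ^ 2) = κ ^ 10 * nM ^ 2 := by ring
    rw [e]
    have : (2630455808 * 64 * 64 * (64 * c) : ℝ) ≤ 10 ^ 100 := by rw [hc]; norm_num
    linarith
  have H4 : 2 < (δB / 2) ^ 2 * nL := by
    rw [hδB]
    have h6 := hpowL 6 (by norm_num)
    have e : ((κ / 2) ^ 3 / c / 2) ^ 2 * nL = κ ^ 6 * nL / (2 ^ 8 * c ^ 2) := by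
      field_simp
    rw [e, lt_div_iff₀ (by positivity)]
    have : (2 * (2 ^ 8 * c ^ 2) : ℝ) < 10 ^ 50 := by rw [hc]; norm_num
    linarith
  have H5 : δ₁C ≤ δC / 8 := by
    rw [eδ₁C, eδC8, div_le_div_iff₀ (by positivity) (by positivity)]
    have h34 := hnL34
    have h150 : (10 : ℝ) ^ 150 ≤ κ ^ 34 * nL * nM ^ 2 := by
      calc (10 : ℝ) ^ 150 = (10 : ℝ) ^ 50 * ((10 : ℝ) ^ 50 * (10 : ℝ) ^ 50) := by norm_num
        _ ≤ (κ ^ 34 * nL) * (nM * nM) :=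
            mul_le_mul h34 (mul_le_mul hnM0 hnM0 (by positivity) hnMpos.le) (by positivity)
              (by positivity)
        _ = κ ^ 34 * nL * nM ^ 2 := by ring
    have e : κ ^ 9 * (κ ^ 25 * nL * nM ^ 2) = κ ^ 34 * nL * nM ^ 2 := by ring
    rw [e]
    have : (2630455808 ^ 2 * 64 ^ 3 * (8 * c) ^ 6 * (8 * ((8 * c) ^ 3 * c)) : ℝ) ≤ 10 ^ 150 := by
      rw [hc]; norm_num
    linarith
  have H6 : 2 < (δC / 2) ^ 2 * nL := by
    rw [hδC, hδB]
    have h18 := hpowL 18 (by norm_num)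
    have e : (((κ / 2) ^ 3 / c) ^ 3 / c / 2) ^ 2 * nL =
        κ ^ 18 * nL / (2 ^ 20 * c ^ 8) := by field_simp
    rw [e, lt_div_iff₀ (by positivity)]
    have : (2 * (2 ^ 20 * c ^ 8) : ℝ) < 10 ^ 50 := by rw [hc]; norm_num
    linarith
  obtain ⟨q, hq1, hqQ, hqd⟩ := regrouped_denominator wt hwt χ₁ χ₂ hχ₁ hχ₂ β θ d w s t l₀ m₀
    hη hη1 hκ hδ₁A hδB hδ₁B hδC hδ₁C H1 H2 H3 H4 H5 H6 hlarge
  refine ⟨q, hq1, ?_, ?_⟩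
  · refine hqQ.trans ?_
    have eQ : 25672 / (κ / 2) ^ 2 * (25672 / δB ^ 2) * (25672 / δC ^ 2) =
        25672 ^ 3 * 4 * (8 * c) ^ 2 * ((8 * c) ^ 3 * c) ^ 2 / κ ^ 26 := by
      rw [hδC, hδB]; field_simp; ring
    rw [eQ]
    exact div_le_div_of_nonneg_right (by rw [hc]; norm_num) (by positivity)
  · rw [← hnL] at hqd
    refine hqd.trans ?_
    have eδC : δC = κ ^ 9 / (512 * c ^ 4) := by rw [hδC, hδB]; field_simp; ring
    set a₀ : ℝ := (2630455808 : ℝ) with ha₀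
    have eD : a₀ * 64 * δ₁C / (δC ^ 6 * nL) =
        a₀ ^ 3 * 64 ^ 4 * 8 ^ 6 * 512 ^ 6 * c ^ 30 / (κ ^ 79 * (nL ^ 2 * nM ^ 2)) := by
      rw [eδ₁C, eδC]
      field_simp
    have h1 : a₀ ^ 3 ≤ 19 * 10 ^ 27 := by rw [ha₀]; norm_num
    have h2 : c ^ 30 ≤ 21 * 10 ^ 140 := by rw [hc]; norm_num
    have h3 : (64 : ℝ) ^ 4 * 8 ^ 6 * 512 ^ 6 ≤ 8 * 10 ^ 28 := by norm_num
    have ha₀0 : 0 ≤ a₀ := by rw [ha₀]; norm_num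
    have hfin : a₀ ^ 3 * 64 ^ 4 * 8 ^ 6 * 512 ^ 6 * c ^ 30 ≤ 10 ^ 200 := by
      calc a₀ ^ 3 * 64 ^ 4 * 8 ^ 6 * 512 ^ 6 * c ^ 30
          = a₀ ^ 3 * ((64 : ℝ) ^ 4 * 8 ^ 6 * 512 ^ 6) * c ^ 30 := by ring
        _ ≤ (19 * 10 ^ 27) * (8 * 10 ^ 28) * (21 * 10 ^ 140) := by gcongr
        _ ≤ 10 ^ 200 := by norm_num
    have hden : 0 < κ ^ 79 * (nL ^ 2 * nM ^ 2) := by positivity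
    have hR : a₀ ^ 3 * 64 ^ 4 * 8 ^ 6 * 512 ^ 6 * c ^ 30 / (κ ^ 79 * (nL ^ 2 * nM ^ 2)) ≤
        10 ^ 200 / (κ ^ 79 * (nL ^ 2 * nM ^ 2)) := div_le_div_of_nonneg_right hfin hden.le
    exact eD ▸ hR

end Summit.Parity.GeneralizedHardyLittlewood.GreenTaoLevelTwoMNTwoRegroupedDenominatorPoly
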